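import Literature.NumberTheory.Automorphic.GLnAdelicStructureProofs
import Summits.Langlands.Langlands.Theorems.IrreducibilityBySelfDualityEssSelfDualIrreducibleCMAdjoint
import Summits.Langlands.Langlands.Theorems.IrreducibilityBySelfDualityEssSelfDualIrreducibleCMSchur
import Summits.Langlands.Langlands.Theorems.IrreducibilityBySelfDualityEssSelfDualIrreducibleCMDiagonal
import Summits.Langlands.Langlands.Theorems.IrreducibilityBySelfDualityEssSelfDualIrreducibleCMQuadratic
import Summits.Langlands.Langlands.Theorems.IrreducibilityBySelfDualityEssSelfDualIrreducibleCMTraceIdentity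
import HarnessLib

/-!
# `EssSelfDualIrreducibleCM` (item stmt-Langlands-13618 of route `IrreducibilityBySelfDuality`) — PROOF

Over a CM field `K`, for `π` regular algebraic cuspidal on `GL₃(𝔸_K)` essentially self-dual at Satake
level, given lang.S27 (`GaloisRepOfRegularAlgebraic`), Ramakrishnan's Theorem A
(`SelfdualGL3AdjointLift`) and the crux `RegularAdjointLiftCM` as antecedents, EVERY semisimple
`r : Γ_K → GL₃(ℚ̄_ℓ)` compatible with `(π, ι)` almost everywhere (C-normalisation
`arithFrobPolyOfSatake ι q_v 3`) and without three linearly independent common eigenvectors is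
irreducible — at every `ℓ` and every `ι`.

## Proof (`isIrreducible_of_compatible`)
With `(σ, ν)` from `RegularAdjointLiftCM` (`σ` regular algebraic cuspidal on `GL₂`, non-dihedral at
Satake level; `t_{π,v} = d_v · Ad(t_{σ,v})` a.e.), `ρ₁ = r_{ℓ,ι}(σ)` and `ψ = r_{ℓ,ι}(ν)` from
lang.S27 at `n = 2, 1`, and the `ℚ̄_ℓ`-valued cyclotomic character:
1. `tr r(g) · χ_cyc(g) ψ(g)⁻¹ + 1 = tr ρ₁(g) tr ρ₁(g⁻¹)` on `Γ_K` (`trace_identity`: Satake algebra at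
   good Frobenii, Chebotarev density, continuity); twist `r' = r ⊗ χ_cyc ψ⁻¹`, so
   `χ_{r'} + 1 = χ_{ρ₁} χ_{ρ₁^∨}`, and `r'` is semisimple / irreducible / has three stable lines iff
   `r` does.
2. `ρ₁` reducible: `tr ρ₁ = χ₁ + χ₂` (`exists_characters_of_not_isIrreducible`), so
   `χ_{r'} = 1 + μ + μ⁻¹`; Brauer–Nesbitt for semisimple representations
   (`exists_three_eigenlines_of_character_eq`) gives three independent stable lines of `r'`, hence of
   `r` — excluded.
3. `ρ₁` irreducible: the trace-zero adjoint representation `Ad⁰ ρ₁` on `ℚ̄_ℓ³` (`exists_adZero`,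
   character `χ_{ρ₁} χ_{ρ₁^∨} - 1 = χ_{r'}`) is irreducible — otherwise it has an eigen-line
   `ℚ̄_ℓ T` (`exists_eigenmatrix_of_not_isIrreducible`: a stable plane gives the commutator of a basis)
   with eigencharacter `χ`; `T` is invertible (`det_ne_zero_of_eigenmatrix`: `ker T` would be
   stable), `χ ≠ 1` (`exists_ne_one_of_eigenmatrix_of_trace_eq_zero`: Schur), `χ² = 1` and
   `ρ₁ ≅ ρ₁ ⊗ χ` (`charpoly_smul_eq_of_eigenmatrix`); `ker χ` is open of index `2`
   (`isOpen_ker_of_eigenmatrix`, `index_ker_eq_two`) and cuts out a quadratic `L/K` with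
   `χ(Frob_v) = 1 ↔ v` split (`exists_quadratic_frob_mem_iff`), so `t_{σ,v} = ε_{L/K}(v) t_{σ,v}`
   a.e. (`map_neg_eq_of_charpoly_neg_eq`) — contradicting non-dihedrality.  Hence `Ad⁰ ρ₁` is
   irreducible, so semisimple, and Brauer–Nesbitt (`nonempty_equiv_of_character_eq_of_isSemisimple`)
   gives `r' ≅ Ad⁰ ρ₁` irreducible.

The closing theorem `EssSelfDualIrreducibleCM_proof` is stated STRUCTURALLY (the route decl's text
with the by-name antecedent `RegularAdjointLiftCM` replaced by its body) so that this module does not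
import the Theses file; it is definitionally the route decl.

References: G. Böckle, C.-Y. Hui, *Irreducibility of …* (2025), §3.2 (the totally real case);
D. Ramakrishnan, *An exercise concerning the selfdual cusp forms on GL(3)* (2014), Thm A;
P. Deligne, J.-P. Serre (1974), Lemme 3.2 (Chebotarev + Brauer–Nesbitt); N. Bourbaki, A VIII §20 n°6.
-/

noncomputable section

set_option linter.dupNamespace false -- project-wide option (lakefile weak.linter.dupNamespace); `Summit.Langlands.Langlands` is the mandated namespace

open scoped NumberField Classical
open Matrix Polynomial Filter IsDedekindDomain Field
open Literature.NumberTheory.Automorphic Literature.NumberTheory.GaloisRepresentations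

namespace Summit.Langlands.Langlands.Theorems.EssSelfDualIrreducibleCM

/-! ### The item, in Literature vocabulary -/

/-- **`EssSelfDualIrreducibleCM`, core form.**  Let `K` be a number field, `π` cuspidal on `GL₃`,
`σ` cuspidal on `GL₂` with NO almost-everywhere Satake self-twist by the sign `ε_{L/K}` of any
quadratic `L/K`, `ν` a `GL₁` datum with `t_{π,v} = d_v · Ad(t_{σ,v})` almost everywhere, `ρ₁`, `ψ`
`ℓ`-adic representations compatible with `σ`, `ν` at every unramified `v ∤ ℓ`, and `r` a SEMISIMPLE
rank-3 representation compatible with `π` almost everywhere, without three linearly independent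
common eigenvectors.  Then `r` is irreducible.  Proof: twist `r' = r ⊗ χ_cyc ψ⁻¹`, so that
`χ_{r'} + 1 = χ_{ρ₁} χ_{ρ₁^∨}` on `Γ_K` (`trace_identity`).  If `ρ₁` is reducible its trace is
`χ₁ + χ₂` and `χ_{r'} = 1 + μ + μ⁻¹`, so Brauer–Nesbitt gives three stable lines — excluded.  If `ρ₁`
is irreducible then `Ad⁰ ρ₁` is irreducible: an eigen-line `T` of `Ad⁰` (from any stable subspace)
is invertible (its kernel would be stable), has eigencharacter `χ ≠ 1` (Schur: a commuting
trace-zero `T` vanishes) with `χ² = 1` and `ρ₁ ≅ ρ₁ ⊗ χ`, and the quadratic field cut out by `χ`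
makes `σ` dihedral at Satake level — excluded; so Brauer–Nesbitt `r' ≅ Ad⁰ ρ₁` makes `r'`, hence
`r`, irreducible.  (Böckle–Hui 2025 §3.2 over totally real fields; Ramakrishnan 2014 for the
descent.) [folklore] -/
theorem isIrreducible_of_compatible {K : Type} [Field K] [NumberField K] {ℓ : ℕ} [Fact ℓ.Prime]
    (ι : PadicAlgCl ℓ ≃+* ℂ)
    {h1 : isCompact_glFiniteIntegralLevel 1 K} {hcpt₂ : isCompact_glFiniteIntegralLevel 2 K}
    {hcpt : isCompact_glFiniteIntegralLevel 3 K}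
    (π : CuspidalAutomorphicRepData 3 K hcpt) (σ : CuspidalAutomorphicRepData 2 K hcpt₂)
    (ν : CuspidalAutomorphicRepData 1 K h1)
    (hnd : ∀ (L : Type) [Field L] [NumberField L] [Algebra K L], Module.finrank K L = 2 →
      ¬ (∀ᶠ v : HeightOneSpectrum (𝓞 K) in cofinite, ∀ β : Multiset ℂ, σ.1.HasSatakeParamAt v β →
        β.map (fun b => (if ∃ w : HeightOneSpectrum (𝓞 L), w.asIdeal.under (𝓞 K) = v.asIdeal ∧
          w.asIdeal.inertiaDeg (𝓞 K) = 1 then (1 : ℂ) else -1) * b) = β))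
    (hAd : ∀ᶠ v : HeightOneSpectrum (𝓞 K) in cofinite, ∀ α β : Multiset ℂ, π.1.HasSatakeParamAt v α →
      σ.1.HasSatakeParamAt v β → ∃ d : ℂ, ν.1.HasSatakeParamAt v {d} ∧
        α = (((β ×ˢ β).map (fun p : ℂ × ℂ => p.1 * p.2⁻¹)).erase 1).map (fun c => d * c))
    (ρ₁ : FramedGaloisRep K (PadicAlgCl ℓ) 2)
    (hρ₁ : ∀ (v : HeightOneSpectrum (𝓞 K)) (β : Multiset ℂ), σ.1.HasSatakeParamAt v β →
      ((ℓ : ℕ) : 𝓞 K) ∉ v.asIdeal → ρ₁.IsUnramifiedAt v ∧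
        ρ₁.HasFrobCharpolyAt v (arithFrobPolyOfSatake ι v.residueCard 2 β))
    (ψ : FramedGaloisRep K (PadicAlgCl ℓ) 1)
    (hψ : ∀ (v : HeightOneSpectrum (𝓞 K)) (γ : Multiset ℂ), ν.1.HasSatakeParamAt v γ →
      ((ℓ : ℕ) : 𝓞 K) ∉ v.asIdeal → ψ.IsUnramifiedAt v ∧
        ψ.HasFrobCharpolyAt v (arithFrobPolyOfSatake ι v.residueCard 1 γ))
    (r : FramedGaloisRep K (PadicAlgCl ℓ) 3) (hrss : r.toGaloisRep.IsSemisimple)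
    (hr : ∀ᶠ v : HeightOneSpectrum (𝓞 K) in cofinite, ∀ α : Multiset ℂ, π.1.HasSatakeParamAt v α →
      r.IsUnramifiedAt v ∧ r.HasFrobCharpolyAt v (arithFrobPolyOfSatake ι v.residueCard 3 α))
    (h3 : ¬ (∃ x : Fin 3 → (Fin 3 → PadicAlgCl ℓ), LinearIndependent (PadicAlgCl ℓ) x ∧
      ∀ (i : Fin 3) (g : absoluteGaloisGroup K), ∃ c : PadicAlgCl ℓ, r.toGaloisRep g (x i) = c • x i)) :
    r.toGaloisRep.IsIrreducible := by
  classical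
  obtain ⟨cyc, hcyc⟩ := FramedGaloisRep.exists_cyclotomic_padicAlgCl K ℓ
  set cχ : absoluteGaloisGroup K →ₜ* (PadicAlgCl ℓ)ˣ := FramedRep.det cyc * (FramedRep.det ψ)⁻¹ with hcχ
  have hkey : ∀ g, FramedRep.trace r g * (cχ g : PadicAlgCl ℓ) + 1 =
      FramedRep.trace ρ₁ g * FramedRep.trace ρ₁ g⁻¹ := fun g =>
    trace_identity ι π σ ν hAd ρ₁ hρ₁ ψ hψ cyc hcyc r hr g
  -- the twist `r' = r ⊗ χ_cyc ψ⁻¹`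
  set r' : FramedGaloisRep K (PadicAlgCl ℓ) 3 := FramedRep.twist r cχ with hr'
  have htw : FramedRep.toRepresentation r' =
      Literature.RepresentationTheory.Semisimple.Representation.twist (FramedRep.toRepresentation r)
        cχ.toMonoidHom := toRepresentation_twist r cχ
  have hrss0 : (FramedRep.toRepresentation r).IsSemisimpleRepresentation := hrss
  haveI hr'ss : (FramedRep.toRepresentation r').IsSemisimpleRepresentation := by
    rw [htw]
    exact (Literature.RepresentationTheory.Semisimple.Representation.isSemisimpleRepresentation_twist_iff
      _ _).mpr hrss0
  have hchar' : ∀ g, (FramedRep.toRepresentation r').character g =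
      FramedRep.trace ρ₁ g * FramedRep.trace ρ₁ g⁻¹ - 1 := fun g => by
    rw [show (FramedRep.toRepresentation r').character g = FramedRep.trace r' g from
      FramedGaloisRep.character_toRepresentation r' g, hr', trace_twist, ← hkey g]
    ring
  -- it suffices to prove that `r'` is irreducible
  suffices hirr' : (FramedRep.toRepresentation r').IsIrreducible by
    rw [htw] at hirr'
    exact (Literature.RepresentationTheory.Semisimple.Representation.isIrreducible_twist_iff _ _).mp hirr'
  have h2 : (2 : PadicAlgCl ℓ) ≠ 0 := two_ne_zero
  by_cases hρ : (FramedRep.toRepresentation ρ₁).IsIrreducible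
  · /- Case `ρ₁` irreducible: `Ad⁰ ρ₁` is irreducible, and `r' ≅ Ad⁰ ρ₁`. -/
    have hρ' : Representation.IsIrreducible ((Representation.ofDistribMulAction (PadicAlgCl ℓ)
        (GL (Fin 2) (PadicAlgCl ℓ)) (Fin 2 → PadicAlgCl ℓ)).comp ρ₁.toMonoidHom) := hρ
    obtain ⟨Ad, φ, hφinj, hφtr, hAdφ, hAdchar⟩ := exists_adZero (k := PadicAlgCl ℓ) ρ₁.toMonoidHom
    have hAdirr : Ad.IsIrreducible := by
      by_contra hnot
      obtain ⟨T, χ, hT, hTtr, hconj⟩ := exists_eigenmatrix_of_not_isIrreducible h2 ρ₁.toMonoidHom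
        (Module.finrank_fin_fun (PadicAlgCl ℓ)) Ad φ hφinj hφtr hAdφ hnot
      have hdet : T.det ≠ 0 :=
        det_ne_zero_of_eigenmatrix ρ₁.toMonoidHom hρ' hT (χ := fun g => (χ g : PadicAlgCl ℓ)) hconj
      obtain ⟨g₀, hg₀⟩ := exists_ne_one_of_eigenmatrix_of_trace_eq_zero h2 ρ₁.toMonoidHom hρ' hT hTtr
        (χ := fun g => (χ g : PadicAlgCl ℓ)) hconj
      have hsq : ∀ g, (χ g : PadicAlgCl ℓ) ^ 2 = 1 := fun g =>
        sq_eq_one_of_eigenmatrix ρ₁.toMonoidHom hdet (χ := fun g => (χ g : PadicAlgCl ℓ)) hconj g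
      have hcp : ∀ g, ((χ g : PadicAlgCl ℓ) • ((ρ₁ g : GL (Fin 2) (PadicAlgCl ℓ)) :
          Matrix (Fin 2) (Fin 2) (PadicAlgCl ℓ))).charpoly =
            ((ρ₁ g : GL (Fin 2) (PadicAlgCl ℓ)) : Matrix (Fin 2) (Fin 2) (PadicAlgCl ℓ)).charpoly :=
        fun g => charpoly_smul_eq_of_eigenmatrix ρ₁.toMonoidHom hT hdet
          (χ := fun g => (χ g : PadicAlgCl ℓ)) hconj g
      -- `H = ker χ` is open of index `2`; the quadratic field it cuts out
      have hopen : IsOpen (χ.ker : Set (absoluteGaloisGroup K)) :=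
        isOpen_ker_of_eigenmatrix h2 ρ₁ hT χ hconj hsq
      have hg₀' : χ g₀ ≠ 1 := fun h => hg₀ (by simp only [h, Units.val_one])
      have hidx : χ.ker.index = 2 := index_ker_eq_two h2 χ hsq hg₀'
      obtain ⟨L, _, _, _, hL2, hdict⟩ := exists_quadratic_frob_mem_iff K χ.ker hopen hidx
      refine hnd L hL2 ?_
      filter_upwards [hdict, FramedGaloisRep.eventually_natCast_not_mem K ℓ] with v hv hℓ
      intro β hβ
      obtain ⟨𝔓, h𝔓⟩ := HeightOneSpectrum.primesAbove_nonempty v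
      obtain ⟨Φ, hΦ⟩ := HeightOneSpectrum.exists_isArithFrobAt_of_mem_primesAbove_holds (v := v) h𝔓
      have hcpΦ : FramedRep.charpoly ρ₁ Φ = arithFrobPolyOfSatake ι v.residueCard 2 β :=
        (hρ₁ v β hβ hℓ).2 𝔓 h𝔓 Φ hΦ
      by_cases hΦ1 : Φ ∈ χ.ker
      · have hP : ∃ w : HeightOneSpectrum (𝓞 L), w.asIdeal.under (𝓞 K) = v.asIdeal ∧
            w.asIdeal.inertiaDeg (𝓞 K) = 1 := (hv 𝔓 h𝔓 Φ hΦ).mp hΦ1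
        simp only [if_pos hP, one_mul, Multiset.map_id']
      · have hP : ¬ ∃ w : HeightOneSpectrum (𝓞 L), w.asIdeal.under (𝓞 K) = v.asIdeal ∧
            w.asIdeal.inertiaDeg (𝓞 K) = 1 := fun h => hΦ1 ((hv 𝔓 h𝔓 Φ hΦ).mpr h)
        simp only [if_neg hP]
        have hχΦ : (χ Φ : PadicAlgCl ℓ) = -1 := by
          have : ((χ Φ : PadicAlgCl ℓ) - 1) * ((χ Φ : PadicAlgCl ℓ) + 1) = 0 := by
            linear_combination hsq Φ
          rcases mul_eq_zero.mp this with h0 | h0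
          · exact absurd (Units.val_eq_one.mp (sub_eq_zero.mp h0)) hΦ1
          · exact eq_neg_of_add_eq_zero_left h0
        have hq : v.residueCard ≠ 0 := by
          have := HeightOneSpectrum.one_lt_residueCard v
          omega
        unfold FramedRep.charpoly at hcpΦ
        refine map_neg_eq_of_charpoly_neg_eq ι hq hcpΦ ?_
        rw [Units.val_neg, Units.val_one, ← hχΦ]
        exact hcp Φ
    -- Brauer–Nesbitt: `Ad ≅ r'`
    haveI : Ad.IsIrreducible := hAdirr
    haveI : Ad.IsSemisimpleRepresentation := inferInstance
    have hch : Ad.character = (FramedRep.toRepresentation r').character := by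
      funext g
      rw [hAdchar, hchar']
      unfold FramedRep.trace
      rw [map_inv]
      rfl
    obtain ⟨e⟩ := Literature.RepresentationTheory.Semisimple.Representation.nonempty_equiv_of_character_eq_of_isSemisimple
      Ad (FramedRep.toRepresentation r') hch
    exact Literature.RepresentationTheory.Semisimple.Representation.isIrreducible_of_equiv e
  · /- Case `ρ₁` reducible: `χ_{r'} = 1 + μ + μ⁻¹`, three stable lines. -/
    exfalso
    obtain ⟨χ₁, χ₂, hχ⟩ := exists_characters_of_not_isIrreducible ρ₁.toMonoidHom hρ
    have htr : ∀ g, FramedRep.trace ρ₁ g = (χ₁ g : PadicAlgCl ℓ) + (χ₂ g : PadicAlgCl ℓ) := fun g => hχ g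
    set μ : absoluteGaloisGroup K →* (PadicAlgCl ℓ)ˣ := χ₁ * χ₂⁻¹ with hμ
    have hcharμ : ∀ g, (FramedRep.toRepresentation r').character g =
        1 + (μ g : PadicAlgCl ℓ) + ((μ g)⁻¹ : (PadicAlgCl ℓ)ˣ) := fun g => by
      rw [hchar', htr, htr g⁻¹, map_inv, map_inv, hμ, MonoidHom.mul_apply, MonoidHom.inv_apply]
      simp only [_root_.mul_inv_rev, inv_inv, Units.val_mul, Units.val_inv_eq_inv_val]
      have h₁ : (χ₁ g : PadicAlgCl ℓ) ≠ 0 := Units.ne_zero _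
      have h₂ : (χ₂ g : PadicAlgCl ℓ) ≠ 0 := Units.ne_zero _
      field_simp
      ring
    obtain ⟨x, hx, hlines⟩ := exists_three_eigenlines_of_character_eq (FramedRep.toRepresentation r') μ hcharμ
    apply h3
    refine ⟨x, hx, fun i g => ?_⟩
    obtain ⟨c, hc⟩ := hlines i g
    rw [FramedRep.toRepresentation_apply_apply, hr', FramedRep.coe_twist_apply, Matrix.smul_mulVec] at hc
    refine ⟨(cχ g : PadicAlgCl ℓ)⁻¹ * c, ?_⟩
    change ((r g : GL (Fin 3) (PadicAlgCl ℓ)) : Matrix (Fin 3) (Fin 3) (PadicAlgCl ℓ)) *ᵥ x i = _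
    calc ((r g : GL (Fin 3) (PadicAlgCl ℓ)) : Matrix (Fin 3) (Fin 3) (PadicAlgCl ℓ)) *ᵥ x i
        = (cχ g : PadicAlgCl ℓ)⁻¹ • ((cχ g : PadicAlgCl ℓ) •
            (((r g : GL (Fin 3) (PadicAlgCl ℓ)) : Matrix (Fin 3) (Fin 3) (PadicAlgCl ℓ)) *ᵥ x i)) := by
          rw [smul_smul, inv_mul_cancel₀ (Units.ne_zero _), one_smul]
      _ = ((cχ g : PadicAlgCl ℓ)⁻¹ * c) • x i := by rw [hc, smul_smul]


/-! ### The item `EssSelfDualIrreducibleCM` (stmt-Langlands-13618), structural form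

The statement below is the TEXT of the route decl
`Summit.Langlands.Langlands.Theses.IrreducibilityBySelfDuality.EssSelfDualIrreducibleCM` with its
by-name antecedent `RegularAdjointLiftCM` replaced by that decl's body (verbatim), so that this module
does not import the Theses file (the gate's `_holds` link imports the proving module into the Theses
file; cf. the 2026-08-15 cycle incident recorded on `IrreducibleGL3CM`).  It is definitionally equal to
the route decl (`example : EssSelfDualIrreducibleCM := EssSelfDualIrreducibleCM_proof` elaborates
against the Theses module). -/

/-- **Item `EssSelfDualIrreducibleCM` of route `IrreducibilityBySelfDuality`** (K CM, `π` regular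
algebraic cuspidal on `GL₃(𝔸_K)` essentially self-dual at Satake level; given lang.S27, Ramakrishnan's
Theorem A and `RegularAdjointLiftCM` as antecedents, EVERY semisimple `r : Γ_K → GL₃(ℚ̄_ℓ)`
compatible with `(π, ι)` almost everywhere and without three independent stable lines is irreducible).
Proof: `RegularAdjointLiftCM` (fed with Ramakrishnan's Theorem A) gives `(σ, ν)`, lang.S27 at
`n = 2, 1` gives `ρ₁ = r_{ℓ,ι}(σ)`, `ψ = r_{ℓ,ι}(ν)`, and `isIrreducible_of_compatible` concludes
(the level-2 witness is `isCompact_glFiniteIntegralLevel_holds 2 K`; the hypotheses "`K` CM" and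
"`π` regular algebraic" are only used to feed the antecedents). [folklore] -/
theorem EssSelfDualIrreducibleCM_proof :
    (∀ (n : ℕ) (K : Type) [Field K] [NumberField K] (hcpt :
      Literature.NumberTheory.Automorphic.isCompact_glFiniteIntegralLevel n K),
      (NumberField.IsTotallyReal K ∨ NumberField.IsCMField K) → ∀ (π :
      Literature.NumberTheory.Automorphic.CuspidalAutomorphicRepData n K hcpt),
      π.1.IsRegularAlgebraic → ∀ (ℓ : ℕ) [Fact ℓ.Prime] (ι : PadicAlgCl ℓ ≃+* ℂ), ∃ r :
      Literature.NumberTheory.GaloisRepresentations.FramedGaloisRep K (PadicAlgCl ℓ) n,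
      r.toGaloisRep.IsSemisimple ∧ ∀ (v : IsDedekindDomain.HeightOneSpectrum
      (NumberField.RingOfIntegers K)) (α : Multiset ℂ), π.1.HasSatakeParamAt v α → ((ℓ : ℕ) :
      NumberField.RingOfIntegers K) ∉ v.asIdeal → r.IsUnramifiedAt v ∧ r.HasFrobCharpolyAt v
      (Literature.NumberTheory.Automorphic.arithFrobPolyOfSatake ι v.residueCard n α)) → (∀ (F :
      Type) [Field F] [NumberField F] (hF1 : _) (hF2 : _) (hF3 : _) (P :
      Literature.NumberTheory.Automorphic.CuspidalAutomorphicRepData 3 F hF3) (η :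
      Literature.NumberTheory.Automorphic.CuspidalAutomorphicRepData 1 F hF1), (∀ᶠ v in cofinite, ∀
      α : Multiset ℂ, P.1.HasSatakeParamAt v α → ∃ e : ℂ, η.1.HasSatakeParamAt v {e} ∧ α.map (fun a
      => a⁻¹) = α.map (fun a => e * a)) → ∃ (π :
      Literature.NumberTheory.Automorphic.CuspidalAutomorphicRepData 2 F hF2) (ν :
      Literature.NumberTheory.Automorphic.CuspidalAutomorphicRepData 1 F hF1), (∀ (L : Type) [Field
      L] [NumberField L] [Algebra F L], Module.finrank F L = 2 → ¬ (∀ᶠ v in cofinite, ∀ β : Multiset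
      ℂ, π.1.HasSatakeParamAt v β → β.map (fun b => (if ∃ w : IsDedekindDomain.HeightOneSpectrum
      (NumberField.RingOfIntegers L), w.asIdeal.under (NumberField.RingOfIntegers F) = v.asIdeal ∧
      w.asIdeal.inertiaDeg (NumberField.RingOfIntegers F) = 1 then (1 : ℂ) else -1) * b) = β)) ∧ ∀ᶠ
      v in cofinite, ∀ β : Multiset ℂ, π.1.HasSatakeParamAt v β → ∃ d e : ℂ, ν.1.HasSatakeParamAt v
      {d} ∧ η.1.HasSatakeParamAt v {e} ∧ d ^ 2 * e = 1 ∧ P.1.HasSatakeParamAt v ((((β ×ˢ β).map (fun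
      p : ℂ × ℂ => p.1 * p.2⁻¹)).erase 1).map (fun c => d * c))) → ((∀ (F : Type) [Field F]
      [NumberField F] (hF1 : _) (hF2 : _) (hF3 : _) (P :
      Literature.NumberTheory.Automorphic.CuspidalAutomorphicRepData 3 F hF3) (η :
      Literature.NumberTheory.Automorphic.CuspidalAutomorphicRepData 1 F hF1), (∀ᶠ v in cofinite, ∀
      α : Multiset ℂ, P.1.HasSatakeParamAt v α → ∃ e : ℂ, η.1.HasSatakeParamAt v {e} ∧ α.map (fun a
      => a⁻¹) = α.map (fun a => e * a)) → ∃ (π :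
      Literature.NumberTheory.Automorphic.CuspidalAutomorphicRepData 2 F hF2) (ν :
      Literature.NumberTheory.Automorphic.CuspidalAutomorphicRepData 1 F hF1), (∀ (L : Type) [Field
      L] [NumberField L] [Algebra F L], Module.finrank F L = 2 → ¬ (∀ᶠ v in cofinite, ∀ β : Multiset
      ℂ, π.1.HasSatakeParamAt v β → β.map (fun b => (if ∃ w : IsDedekindDomain.HeightOneSpectrum
      (NumberField.RingOfIntegers L), w.asIdeal.under (NumberField.RingOfIntegers F) = v.asIdeal ∧
      w.asIdeal.inertiaDeg (NumberField.RingOfIntegers F) = 1 then (1 : ℂ) else -1) * b) = β)) ∧ ∀ᶠ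
      v in cofinite, ∀ β : Multiset ℂ, π.1.HasSatakeParamAt v β → ∃ d e : ℂ, ν.1.HasSatakeParamAt v
      {d} ∧ η.1.HasSatakeParamAt v {e} ∧ d ^ 2 * e = 1 ∧ P.1.HasSatakeParamAt v ((((β ×ˢ β).map (fun
      p : ℂ × ℂ => p.1 * p.2⁻¹)).erase 1).map (fun c => d * c))) → ∀ (K : Type) [Field K]
      [NumberField K], NumberField.IsCMField K → ∀ (h1 : _) (hcpt₂ : _) (hcpt : _) (π :
      Literature.NumberTheory.Automorphic.CuspidalAutomorphicRepData 3 K hcpt),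
      π.1.IsRegularAlgebraic → (∃ η : Literature.NumberTheory.Automorphic.CuspidalAutomorphicRepData
      1 K h1, ∀ᶠ v in cofinite, ∀ α : Multiset ℂ, π.1.HasSatakeParamAt v α → ∃ e : ℂ,
      η.1.HasSatakeParamAt v {e} ∧ α.map (fun a => a⁻¹) = α.map (fun a => e * a)) → ∃ (σ :
      Literature.NumberTheory.Automorphic.CuspidalAutomorphicRepData 2 K hcpt₂) (ν :
      Literature.NumberTheory.Automorphic.CuspidalAutomorphicRepData 1 K h1), σ.1.IsRegularAlgebraic
      ∧ ν.1.IsRegularAlgebraic ∧ (∀ (L : Type) [Field L] [NumberField L] [Algebra K L],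
      Module.finrank K L = 2 → ¬ (∀ᶠ v in cofinite, ∀ β : Multiset ℂ, σ.1.HasSatakeParamAt v β →
      β.map (fun b => (if ∃ w : IsDedekindDomain.HeightOneSpectrum (NumberField.RingOfIntegers L),
      w.asIdeal.under (NumberField.RingOfIntegers K) = v.asIdeal ∧ w.asIdeal.inertiaDeg
      (NumberField.RingOfIntegers K) = 1 then (1 : ℂ) else -1) * b) = β)) ∧ ∀ᶠ v in cofinite, ∀ α β
      : Multiset ℂ, π.1.HasSatakeParamAt v α → σ.1.HasSatakeParamAt v β → ∃ d : ℂ,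
      ν.1.HasSatakeParamAt v {d} ∧ α = (((β ×ˢ β).map (fun p : ℂ × ℂ => p.1 * p.2⁻¹)).erase 1).map
      (fun c => d * c)) → ∀ (K : Type) [Field K] [NumberField K], NumberField.IsCMField K → ∀ (h1 :
      _) (hcpt : _) (π : Literature.NumberTheory.Automorphic.CuspidalAutomorphicRepData 3 K hcpt),
      π.1.IsRegularAlgebraic → (∃ η : Literature.NumberTheory.Automorphic.CuspidalAutomorphicRepData
      1 K h1, ∀ᶠ v in cofinite, ∀ α : Multiset ℂ, π.1.HasSatakeParamAt v α → ∃ e : ℂ,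
      η.1.HasSatakeParamAt v {e} ∧ α.map (fun a => a⁻¹) = α.map (fun a => e * a)) → ∀ (ℓ : ℕ) [Fact
      ℓ.Prime] (ι : PadicAlgCl ℓ ≃+* ℂ) (r :
      Literature.NumberTheory.GaloisRepresentations.FramedGaloisRep K (PadicAlgCl ℓ) 3),
      r.toGaloisRep.IsSemisimple → (∀ᶠ v in cofinite, ∀ α : Multiset ℂ, π.1.HasSatakeParamAt v α →
      r.IsUnramifiedAt v ∧ r.HasFrobCharpolyAt v
      (Literature.NumberTheory.Automorphic.arithFrobPolyOfSatake ι v.residueCard 3 α)) → ¬ (∃ x :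
      Fin 3 → (Fin 3 → PadicAlgCl ℓ), LinearIndependent (PadicAlgCl ℓ) x ∧ ∀ (i : Fin 3) (g :
      Field.absoluteGaloisGroup K), ∃ c : PadicAlgCl ℓ, r.toGaloisRep g (x i) = c • x i) →
      r.toGaloisRep.IsIrreducible := by
  intro hGR hSD hRAL K _ _ hCM h1 hcpt π hRA hess ℓ _ ι r hrss hr h3
  have hcpt₂ : Literature.NumberTheory.Automorphic.isCompact_glFiniteIntegralLevel 2 K :=
    isCompact_glFiniteIntegralLevel_holds 2 K
  obtain ⟨σ, ν, hσRA, hνRA, hnd, hAd⟩ := hRAL hSD K hCM h1 hcpt₂ hcpt π hRA hess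
  obtain ⟨ρ₁, -, hρ₁⟩ := hGR 2 K hcpt₂ (Or.inr hCM) σ hσRA ℓ ι
  obtain ⟨ψ, -, hψ⟩ := hGR 1 K h1 (Or.inr hCM) ν hνRA ℓ ι
  exact isIrreducible_of_compatible ι π σ ν hnd hAd ρ₁ hρ₁ ψ hψ r hrss hr h3

end Summit.Langlands.Langlands.Theorems.EssSelfDualIrreducibleCM

end
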